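import Mathlib.Algebra.Homology.HomologicalComplexAbelian
import Mathlib.Algebra.Homology.ConcreteCategory
import Mathlib.Algebra.Exact.Basic
import Literature.Algebra.Lie.ChevalleyEilenbergHomologyBridge
import Literature.Algebra.Lie.ChevalleyEilenbergFunctoriality
import Literature.Algebra.Lie.ChevalleyEilenbergScalars
import HarnessLib

/-!
# The long exact cohomology sequence of a short exact sequence of Chevalley–Eilenberg subcomplexes

Topic `Algebra/Lie`; namespace `Literature.Algebra.Lie.ChevalleyEilenberg.Subcomplex`.
Definitions with bodies and theorems; no named fact, no `sorry`.  Sequel to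
`ChevalleyEilenbergHomologyBridge` (`cohomologyEquiv : H^q(S) ≃ₗ H^q(S.toComplex)`) and
`ChevalleyEilenbergFunctoriality` (`IsCochainMapTo`, `cohomologyMap`).

For cochain maps `F : S₁ → S₂`, `G : S₂ → S₃` between subcomplexes of Chevalley–Eilenberg
complexes (possibly of different Lie pairs `(Lᵢ, Mᵢ)`; `IsCochainMapTo`):

* `IsCochainMapTo.carrierMap`, `IsCochainMapTo.toComplexMap` — **a cochain map is a morphism of
  cochain complexes `S₁.toComplex ⟶ S₂.toComplex`** (`CochainComplex.ofHom`);
* `cycleOf`, `iCycles_cycleOf`, `cohomologyEquiv_toCohomology` — the bridge on classes: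
  `cohomologyEquiv [z] = homologyπ (cycleOf z)`; `IsCochainMapTo.cohomologyEquiv_cohomologyMap`,
  `homologyMap_comp_cohomologyEquiv` — **naturality of the bridge**
  (`cohomologyEquiv ∘ H^q(F) = H^q(F.toComplexMap) ∘ cohomologyEquiv`);
* `shortComplex`, `shortExact` — if degreewise `F` is injective, `G ∘ F = 0`, `ker G = im F` and
  `G` is surjective on the carriers, then `S₁.toComplex → S₂.toComplex → S₃.toComplex` is a short
  exact sequence of complexes (`HomologicalComplex.shortExact_of_degreewise_shortExact`);
* `delta` — **the connecting homomorphism `δ : H^q(S₃) → H^{q+1}(S₁)`** (Mathlib's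
  `ShortExact.δ` transported along the bridge), and **the long exact sequence in the tree's
  language**: `exact_cohomologyMap` (at `H^q(S₂)`), `exact_delta` (at `H^q(S₃)`),
  `exact_delta_cohomologyMap` (at `H^{q+1}(S₁)`), `delta_comp_cohomologyMap`,
  `cohomologyMap_comp_delta`, `cohomologyMap_zero_injective`
  [cite: ChevalleyEilenberg1948, §24 (exact sequences of modules and their cohomology)].
* **the formula for `δ` and its `A`-linearity** (section `DeltaFormula`): `cyclesMk_eq_cycleOf`,
  `mem_cocycles_of_map_eq_dRes`, `delta_toCohomology` (`δ [z₃] = [x₁]` whenever `G x₂ = z₃` and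
  `F x₁ = d x₂`, from Mathlib's `ShortExact.δ_apply`), `exists_delta_data`, `delta_smul`
  (`δ (a • x) = a • δ x` for `A`-stable subcomplexes and `A`-linear `F`, `G`) [folklore].

Intended use: coefficient sequences `0 → U → V → V/U → 0` of `(𝔤, K)`-modules
(`GKSubquotient`, `GKCohomology`), once the surjectivity `C^q(𝔤, K; V) → C^q(𝔤, K; V/U)` is
supplied (complete reducibility of `K`, `RepresentationTheory/CompactGroups`).

## Mathlib / Literature search

`CochainComplex.ofHom`, `HomologicalComplex.shortExact_of_degreewise_shortExact`,
`ModuleCat.shortComplex_shortExact`, `ShortComplex.ShortExact.δ`, `homology_exact₁/₂/₃`,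
`ShortComplex.ShortExact.moduleCat_exact_iff_function_exact`,
`Function.Exact.iff_of_ladder_linearEquiv`, `ShortComplex.homologyπ_naturality`, `cyclesMap_i`,
`moduleCatCyclesIso_inv_iCycles`, `HomologicalComplex.homologyπ_naturality`/`cyclesMap_i`
(Mathlib).  No prior LES for the tree's CE model (`lean search 'Subcomplex.delta|toComplexMap'`).

## References

* C. Chevalley, S. Eilenberg (1948), §23–§24, §28 [ChevalleyEilenberg1948].
-/

noncomputable section

open CategoryTheory

namespace Literature.Algebra.Lie.ChevalleyEilenberg.Subcomplex

universe u v w v'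

variable {R : Type u} [CommRing R]
  {L₁ L₂ L₃ : Type v} [LieRing L₁] [LieAlgebra R L₁] [LieRing L₂] [LieAlgebra R L₂]
  [LieRing L₃] [LieAlgebra R L₃]
  {M₁ M₂ M₃ : Type w} [AddCommGroup M₁] [Module R M₁] [LieRingModule L₁ M₁] [LieModule R L₁ M₁]
  [AddCommGroup M₂] [Module R M₂] [LieRingModule L₂ M₂] [LieModule R L₂ M₂]
  [AddCommGroup M₃] [Module R M₃] [LieRingModule L₃ M₃] [LieModule R L₃ M₃]
  {S₁ : Subcomplex R L₁ M₁} {S₂ : Subcomplex R L₂ M₂} {S₃ : Subcomplex R L₃ M₃}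
  {F : (q : ℕ) → Cochain R L₁ M₁ q →ₗ[R] Cochain R L₂ M₂ q}
  {G : (q : ℕ) → Cochain R L₂ M₂ q →ₗ[R] Cochain R L₃ M₃ q}


/-! #### Cochain maps as morphisms of cochain complexes -/

namespace IsCochainMapTo

variable (hF : S₁.IsCochainMapTo S₂ F)
include hF

/-- The cochain map on carriers, degreewise. [folklore] -/
def carrierMap (q : ℕ) : S₁.carrier q →ₗ[R] S₂.carrier q :=
  (F q).restrict fun f hf => hF.mapsTo q f hf

/-- Unfolding. [folklore] -/
@[simp] theorem coe_carrierMap (q : ℕ) (f : S₁.carrier q) :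
    (hF.carrierMap q f : Cochain R L₂ M₂ q) = F q f := rfl

/-- `d ∘ F = F ∘ d` on carriers. [folklore] -/
theorem dRes_carrierMap (q : ℕ) (f : S₁.carrier q) :
    S₂.dRes q (hF.carrierMap q f) = hF.carrierMap (q + 1) (S₁.dRes q f) :=
  Subtype.ext (hF.comm q f)

/-- **The morphism of cochain complexes `S₁.toComplex ⟶ S₂.toComplex` of a cochain map.**
[folklore] -/
def toComplexMap : S₁.toComplex ⟶ S₂.toComplex :=
  CochainComplex.ofHom (fun q => ModuleCat.ofHom (hF.carrierMap q)) fun q => by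
    rw [toComplex_d, toComplex_d]
    ext f
    exact hF.dRes_carrierMap q f

/-- Its components. [folklore] -/
@[simp] theorem toComplexMap_f (q : ℕ) :
    hF.toComplexMap.f q = ModuleCat.ofHom (hF.carrierMap q) := rfl

end IsCochainMapTo

/-! #### Cycles of `S.toComplex` from cocycles, and the bridge on classes -/

section Cycles

variable (S : Subcomplex R L₁ M₁)

/-- `d` of `S.toComplex` kills cocycles (in every target degree). [folklore] -/
theorem toComplex_d_apply_eq_zero (q j : ℕ) (z : S.cocycles q) :
    (S.toComplex.d q j) (⟨z, ((S.mem_cocycles_iff q _).1 z.2).1⟩ : S.carrier q) = 0 := by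
  by_cases hj : q + 1 = j
  · subst hj
    rw [toComplex_d]
    exact Subtype.ext ((S.mem_cocycles_iff q _).1 z.2).2
  · rw [S.toComplex.shape q j hj]
    rfl

/-- The cycle of `S.toComplex` defined by a cocycle. [folklore] -/
def cycleOf (q : ℕ) (z : S.cocycles q) : (S.toComplex.cycles q : ModuleCat R) :=
  (S.toComplex.sc q).moduleCatCyclesIso.inv
    ⟨(⟨z, ((S.mem_cocycles_iff q _).1 z.2).1⟩ : S.carrier q), S.toComplex_d_apply_eq_zero q _ z⟩

/-- `iCycles (cycleOf z) = z`. [folklore] -/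
theorem iCycles_cycleOf (q : ℕ) (z : S.cocycles q) :
    (S.toComplex.iCycles q) (S.cycleOf q z) =
      (⟨z, ((S.mem_cocycles_iff q _).1 z.2).1⟩ : S.carrier q) := by
  unfold cycleOf
  erw [ShortComplex.moduleCatCyclesIso_inv_iCycles_apply]
  rfl

end Cycles

/-! #### The bridge on classes: `cohomologyEquiv [z] = homologyπ (cycleOf z)` -/

section Bridge

variable (S : Subcomplex R L₁ M₁)

omit [LieRingModule L₁ M₁] [LieModule R L₁ M₁] in
/-- Apply an identity of morphisms of modules to an element. [folklore] -/
private theorem modHom_congr {X Y : ModuleCat.{v'} R} {f g : X ⟶ Y} (h : f = g) (x : X) :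
    f x = g x := by
  rw [h]

/-- The middle component of `isoScSucc⁻¹` is the identity. [folklore] -/
theorem isoScSucc_inv_τ₂ (q : ℕ) : (S.isoScSucc q).inv.τ₂ = 𝟙 _ := rfl

/-- The middle component of `isoScZero⁻¹` is the identity. [folklore] -/
theorem isoScZero_inv_τ₂ : S.isoScZero.inv.τ₂ = 𝟙 _ := rfl

/-- Injectivity of `iCycles` (a monomorphism of modules). [folklore] -/
theorem iCycles_injective (q : ℕ) : Function.Injective (S.toComplex.iCycles q) :=
  (ModuleCat.mono_iff_injective _).1 inferInstance

/-- The bridge on classes, positive degrees. [folklore] -/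
theorem cohomologyEquiv_toCohomology_succ (q : ℕ) (z : S.cocycles (q + 1)) :
    S.cohomologyEquiv (q + 1) (S.toCohomology (q + 1) z) =
      (S.toComplex.homologyπ (q + 1)) (S.cycleOf (q + 1) z) := by
  -- the element of `ker / range`
  set x : LinearMap.ker (S.dRes (q + 1)) := S.cocyclesEquivKer (q + 1) z with hx
  have h1 : S.cohomologyEquivSucc q (S.toCohomology (q + 1) z) =
      (S.scSucc q).moduleCatLeftHomologyData.π x := rfl
  -- unfold the composite of isomorphisms
  change ((S.scSucc q).moduleCatHomologyIso.symm ≪≫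
      ShortComplex.homologyMapIso (S.isoScSucc q).symm ≪≫
      (S.toComplex.homologyIsoSc' q (q + 1) (q + 2) (CochainComplex.prev_nat_succ q)
        (by simp)).symm).hom (S.cohomologyEquivSucc q (S.toCohomology (q + 1) z)) = _
  rw [h1]
  simp only [Iso.trans_hom, Iso.symm_hom, ShortComplex.homologyMapIso_hom,
    HomologicalComplex.homologyIsoSc', ModuleCat.comp_apply]
  -- step A: `moduleCatHomologyIso.inv (π x) = homologyπ (cyclesIso.inv x)`
  rw [← ShortComplex.moduleCatCyclesIso_inv_π_apply]
  -- step B/C: naturality of `homologyπ`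
  have hB := modHom_congr (ShortComplex.homologyπ_naturality (S.isoScSucc q).inv)
    ((S.scSucc q).moduleCatCyclesIso.inv x)
  simp only [ModuleCat.comp_apply] at hB
  rw [hB]
  have hC := modHom_congr (ShortComplex.homologyπ_naturality
    (S.toComplex.isoSc' q (q + 1) (q + 2) (CochainComplex.prev_nat_succ q) (by simp)).inv)
    (ShortComplex.cyclesMap (S.isoScSucc q).inv ((S.scSucc q).moduleCatCyclesIso.inv x))
  simp only [ModuleCat.comp_apply] at hC
  refine hC.trans ?_
  -- compare the cycles through `iCycles`
  change (S.toComplex.homologyπ (q + 1)) _ = (S.toComplex.homologyπ (q + 1)) _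
  congr 1
  apply S.iCycles_injective (q + 1)
  rw [iCycles_cycleOf]
  change ((S.toComplex.sc (q + 1)).iCycles) _ = _
  have hi1 := modHom_congr (ShortComplex.cyclesMap_i
    (S.toComplex.isoSc' q (q + 1) (q + 2) (CochainComplex.prev_nat_succ q) (by simp)).inv)
    (ShortComplex.cyclesMap (S.isoScSucc q).inv ((S.scSucc q).moduleCatCyclesIso.inv x))
  simp only [ModuleCat.comp_apply] at hi1
  rw [hi1]
  have hi2 := modHom_congr (ShortComplex.cyclesMap_i (S.isoScSucc q).inv)
    ((S.scSucc q).moduleCatCyclesIso.inv x)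
  simp only [ModuleCat.comp_apply] at hi2
  erw [hi2, ShortComplex.moduleCatCyclesIso_inv_iCycles_apply]
  rfl

end Bridge

section BridgeZero

variable (S : Subcomplex R L₁ M₁)

/-- The bridge on classes, degree `0`. [folklore] -/
theorem cohomologyEquiv_toCohomology_zero (z : S.cocycles 0) :
    S.cohomologyEquiv 0 (S.toCohomology 0 z) = (S.toComplex.homologyπ 0) (S.cycleOf 0 z) := by
  set x : LinearMap.ker (S.dRes 0) := S.cocyclesEquivKer 0 z with hx
  have h1 : S.cohomologyEquivZero (S.toCohomology 0 z) = S.scZero.moduleCatLeftHomologyData.π x :=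
    rfl
  change (S.scZero.moduleCatHomologyIso.symm ≪≫ ShortComplex.homologyMapIso S.isoScZero.symm ≪≫
      (S.toComplex.homologyIsoSc' 0 0 1 CochainComplex.prev_nat_zero (by simp)).symm).hom
      (S.cohomologyEquivZero (S.toCohomology 0 z)) = _
  rw [h1]
  simp only [Iso.trans_hom, Iso.symm_hom, ShortComplex.homologyMapIso_hom,
    HomologicalComplex.homologyIsoSc', ModuleCat.comp_apply]
  rw [← ShortComplex.moduleCatCyclesIso_inv_π_apply]
  have hB := modHom_congr (ShortComplex.homologyπ_naturality S.isoScZero.inv)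
    (S.scZero.moduleCatCyclesIso.inv x)
  simp only [ModuleCat.comp_apply] at hB
  rw [hB]
  have hC := modHom_congr (ShortComplex.homologyπ_naturality
    (S.toComplex.isoSc' 0 0 1 CochainComplex.prev_nat_zero (by simp)).inv)
    (ShortComplex.cyclesMap S.isoScZero.inv (S.scZero.moduleCatCyclesIso.inv x))
  simp only [ModuleCat.comp_apply] at hC
  refine hC.trans ?_
  change (S.toComplex.homologyπ 0) _ = (S.toComplex.homologyπ 0) _
  congr 1
  apply S.iCycles_injective 0
  rw [iCycles_cycleOf]
  change ((S.toComplex.sc 0).iCycles) _ = _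
  have hi1 := modHom_congr (ShortComplex.cyclesMap_i
    (S.toComplex.isoSc' 0 0 1 CochainComplex.prev_nat_zero (by simp)).inv)
    (ShortComplex.cyclesMap S.isoScZero.inv (S.scZero.moduleCatCyclesIso.inv x))
  simp only [ModuleCat.comp_apply] at hi1
  rw [hi1]
  have hi2 := modHom_congr (ShortComplex.cyclesMap_i S.isoScZero.inv)
    (S.scZero.moduleCatCyclesIso.inv x)
  simp only [ModuleCat.comp_apply] at hi2
  erw [hi2, ShortComplex.moduleCatCyclesIso_inv_iCycles_apply]
  rfl

/-- **The bridge on classes**: `cohomologyEquiv [z] = homologyπ (cycleOf z)`. [folklore] -/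
theorem cohomologyEquiv_toCohomology (q : ℕ) (z : S.cocycles q) :
    S.cohomologyEquiv q (S.toCohomology q z) = (S.toComplex.homologyπ q) (S.cycleOf q z) := by
  cases q with
  | zero => exact S.cohomologyEquiv_toCohomology_zero z
  | succ q => exact S.cohomologyEquiv_toCohomology_succ q z

end BridgeZero

/-! #### Naturality of the bridge -/

namespace IsCochainMapTo

variable (hF : S₁.IsCochainMapTo S₂ F)
include hF

/-- `cyclesMap F (cycleOf z)` and `cycleOf (F z)` have the same image under `iCycles`.
[folklore] -/
theorem iCycles_cyclesMap_cycleOf (q : ℕ) (z : S₁.cocycles q) :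
    (S₂.toComplex.iCycles q) (HomologicalComplex.cyclesMap hF.toComplexMap q (S₁.cycleOf q z)) =
      (S₂.toComplex.iCycles q) (S₂.cycleOf q (hF.cocyclesMap q z)) := by
  have h := modHom_congr (HomologicalComplex.cyclesMap_i hF.toComplexMap q) (S₁.cycleOf q z)
  simp only [ModuleCat.comp_apply] at h
  rw [h, iCycles_cycleOf, iCycles_cycleOf]
  rfl

/-- **Naturality**: `cohomologyEquiv ∘ H^q(F) = H^q(F.toComplexMap) ∘ cohomologyEquiv`.
[folklore] -/
theorem cohomologyEquiv_cohomologyMap (q : ℕ) (c : S₁.Cohomology q) :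
    S₂.cohomologyEquiv q (hF.cohomologyMap q c) =
      (HomologicalComplex.homologyMap hF.toComplexMap q) (S₁.cohomologyEquiv q c) := by
  obtain ⟨z, rfl⟩ := S₁.toCohomology_surjective q c
  rw [hF.cohomologyMap_toCohomology, cohomologyEquiv_toCohomology, cohomologyEquiv_toCohomology]
  have h := modHom_congr (HomologicalComplex.homologyπ_naturality hF.toComplexMap q)
    (S₁.cycleOf q z)
  simp only [ModuleCat.comp_apply] at h
  rw [h]
  congr 1
  exact (S₂.iCycles_injective q (hF.iCycles_cyclesMap_cycleOf q z)).symm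

/-- The same as an identity of linear maps. [folklore] -/
theorem homologyMap_comp_cohomologyEquiv (q : ℕ) :
    (HomologicalComplex.homologyMap hF.toComplexMap q).hom ∘ₗ (S₁.cohomologyEquiv q).toLinearMap =
      (S₂.cohomologyEquiv q).toLinearMap ∘ₗ hF.cohomologyMap q :=
  LinearMap.ext fun c => (hF.cohomologyEquiv_cohomologyMap q c).symm

end IsCochainMapTo

/-! #### Short exact sequences of subcomplexes and the long exact cohomology sequence -/

section LongExact

variable (hF : S₁.IsCochainMapTo S₂ F) (hG : S₂.IsCochainMapTo S₃ G)
  (hGF : ∀ (q : ℕ) (f : S₁.carrier q), G q (F q f) = 0)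

/-- The short complex of cochain complexes `S₁ → S₂ → S₃` of two composable cochain maps with
`G ∘ F = 0` on `S₁`. [folklore] -/
def shortComplex : ShortComplex (CochainComplex (ModuleCat.{max v w} R) ℕ) :=
  ShortComplex.mk hF.toComplexMap hG.toComplexMap
    (HomologicalComplex.hom_ext _ _ fun q =>
      ModuleCat.hom_ext (LinearMap.ext fun f => Subtype.ext (hGF q f)))

variable (hinj : ∀ q, Function.Injective (hF.carrierMap q))
  (hex : ∀ (q : ℕ) (g : S₂.carrier q), G q g = 0 → ∃ f : S₁.carrier q, F q f = g)
  (hsurj : ∀ q, Function.Surjective (hG.carrierMap q))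
include hGF hinj hex hsurj

/-- **Degreewise short exact ⇒ short exact sequence of complexes.** [folklore] -/
theorem shortExact : (shortComplex hF hG hGF).ShortExact := by
  refine HomologicalComplex.shortExact_of_degreewise_shortExact _ fun q =>
    ModuleCat.shortComplex_shortExact _ ?_ (hinj q) (hsurj q)
  intro g
  change hG.carrierMap q g = 0 ↔ g ∈ Set.range (hF.carrierMap q)
  constructor
  · intro hg
    obtain ⟨f, hf⟩ := hex q g (congrArg Subtype.val hg)
    exact ⟨f, Subtype.ext hf⟩
  · rintro ⟨f, rfl⟩
    exact Subtype.ext (hGF q f)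

/-- **The connecting homomorphism `δ : H^q(S₃) → H^{q+1}(S₁)`** (Mathlib's `ShortExact.δ`
transported along `cohomologyEquiv`). [cite: ChevalleyEilenberg1948, §24] -/
def delta (q : ℕ) : S₃.Cohomology q →ₗ[R] S₁.Cohomology (q + 1) :=
  (S₁.cohomologyEquiv (q + 1)).symm.toLinearMap ∘ₗ
    ((shortExact hF hG hGF hinj hex hsurj).δ q (q + 1) rfl).hom ∘ₗ
      (S₃.cohomologyEquiv q).toLinearMap

/-- `δ` corresponds to Mathlib's `ShortExact.δ` under the bridge. [folklore] -/
theorem cohomologyEquiv_delta (q : ℕ) (c : S₃.Cohomology q) :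
    S₁.cohomologyEquiv (q + 1) (delta hF hG hGF hinj hex hsurj q c) =
      ((shortExact hF hG hGF hinj hex hsurj).δ q (q + 1) rfl) (S₃.cohomologyEquiv q c) := by
  simp only [delta, LinearMap.coe_comp, LinearEquiv.coe_coe, Function.comp_apply,
    LinearEquiv.apply_symm_apply]
  rfl

/-- **Exactness at `H^q(S₂)`**: `ker H^q(G) = im H^q(F)`. [cite: ChevalleyEilenberg1948, §24] -/
theorem exact_cohomologyMap (q : ℕ) :
    Function.Exact (hF.cohomologyMap q) (hG.cohomologyMap q) := by
  have h := (shortExact hF hG hGF hinj hex hsurj).homology_exact₂ q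
  rw [ShortComplex.ShortExact.moduleCat_exact_iff_function_exact] at h
  refine (Function.Exact.iff_of_ladder_linearEquiv (e₁ := S₁.cohomologyEquiv q)
    (e₂ := S₂.cohomologyEquiv q) (e₃ := S₃.cohomologyEquiv q)
    (g₁₂ := (HomologicalComplex.homologyMap hF.toComplexMap q).hom)
    (g₂₃ := (HomologicalComplex.homologyMap hG.toComplexMap q).hom)
    (hF.homologyMap_comp_cohomologyEquiv q) (hG.homologyMap_comp_cohomologyEquiv q)).1 ?_
  exact h

/-- **Exactness at `H^q(S₃)`**: `ker δ = im H^q(G)`. [cite: ChevalleyEilenberg1948, §24] -/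
theorem exact_delta (q : ℕ) :
    Function.Exact (hG.cohomologyMap q) (delta hF hG hGF hinj hex hsurj q) := by
  have h := (shortExact hF hG hGF hinj hex hsurj).homology_exact₃ q (q + 1) rfl
  rw [ShortComplex.ShortExact.moduleCat_exact_iff_function_exact] at h
  refine (Function.Exact.iff_of_ladder_linearEquiv (e₁ := S₂.cohomologyEquiv q)
    (e₂ := S₃.cohomologyEquiv q) (e₃ := S₁.cohomologyEquiv (q + 1))
    (g₁₂ := (HomologicalComplex.homologyMap hG.toComplexMap q).hom)
    (g₂₃ := ((shortExact hF hG hGF hinj hex hsurj).δ q (q + 1) rfl).hom)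
    (hG.homologyMap_comp_cohomologyEquiv q) ?_).1 ?_
  · exact LinearMap.ext fun c => (cohomologyEquiv_delta hF hG hGF hinj hex hsurj q c).symm
  · exact h

/-- **Exactness at `H^{q+1}(S₁)`**: `ker H^{q+1}(F) = im δ`. [cite: ChevalleyEilenberg1948, §24] -/
theorem exact_delta_cohomologyMap (q : ℕ) :
    Function.Exact (delta hF hG hGF hinj hex hsurj q) (hF.cohomologyMap (q + 1)) := by
  have h := (shortExact hF hG hGF hinj hex hsurj).homology_exact₁ q (q + 1) rfl
  rw [ShortComplex.ShortExact.moduleCat_exact_iff_function_exact] at h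
  refine (Function.Exact.iff_of_ladder_linearEquiv (e₁ := S₃.cohomologyEquiv q)
    (e₂ := S₁.cohomologyEquiv (q + 1)) (e₃ := S₂.cohomologyEquiv (q + 1))
    (g₁₂ := ((shortExact hF hG hGF hinj hex hsurj).δ q (q + 1) rfl).hom)
    (g₂₃ := (HomologicalComplex.homologyMap hF.toComplexMap (q + 1)).hom)
    ?_ (hF.homologyMap_comp_cohomologyEquiv (q + 1))).1 ?_
  · exact LinearMap.ext fun c => (cohomologyEquiv_delta hF hG hGF hinj hex hsurj q c).symm
  · exact h

/-- `δ ∘ H^q(G) = 0`. [folklore] -/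
theorem delta_comp_cohomologyMap (q : ℕ) :
    delta hF hG hGF hinj hex hsurj q ∘ₗ hG.cohomologyMap q = 0 :=
  (exact_delta hF hG hGF hinj hex hsurj q).linearMap_comp_eq_zero

/-- `H^{q+1}(F) ∘ δ = 0`. [folklore] -/
theorem cohomologyMap_comp_delta (q : ℕ) :
    hF.cohomologyMap (q + 1) ∘ₗ delta hF hG hGF hinj hex hsurj q = 0 :=
  (exact_delta_cohomologyMap hF hG hGF hinj hex hsurj q).linearMap_comp_eq_zero

omit hGF hex hsurj in
/-- **Injectivity in degree `0`**: `H⁰(F)` is injective. [folklore] -/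
theorem cohomologyMap_zero_injective : Function.Injective (hF.cohomologyMap 0) := by
  intro a b hab
  obtain ⟨za, rfl⟩ := S₁.toCohomology_surjective 0 a
  obtain ⟨zb, rfl⟩ := S₁.toCohomology_surjective 0 b
  rw [hF.cohomologyMap_toCohomology, hF.cohomologyMap_toCohomology, ← sub_eq_zero,
    ← map_sub, toCohomology_eq_zero_iff] at hab
  rw [← sub_eq_zero, ← map_sub, toCohomology_eq_zero_iff]
  change ((za - zb : S₁.cocycles 0) : Cochain R L₁ M₁ 0) ∈ (⊥ : Submodule R _)
  change ((hF.cocyclesMap 0 za - hF.cocyclesMap 0 zb : S₂.cocycles 0) : Cochain R L₂ M₂ 0) ∈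
    (⊥ : Submodule R _) at hab
  rw [Submodule.mem_bot] at hab ⊢
  rw [← map_sub] at hab
  have h0 : hF.carrierMap 0 ⟨(za - zb : S₁.cocycles 0), ((S₁.mem_cocycles_iff 0 _).1
      (za - zb).2).1⟩ = 0 := Subtype.ext hab
  exact congrArg Subtype.val (hinj 0 (h0.trans (map_zero _).symm))

end LongExact

/-! #### The formula for `δ` on cocycles; `A`-linearity -/

section DeltaFormula

variable (hF : S₁.IsCochainMapTo S₂ F) (hG : S₂.IsCochainMapTo S₃ G)
  (hGF : ∀ (q : ℕ) (f : S₁.carrier q), G q (F q f) = 0)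
  (hinj : ∀ q, Function.Injective (hF.carrierMap q))
  (hex : ∀ (q : ℕ) (g : S₂.carrier q), G q g = 0 → ∃ f : S₁.carrier q, F q f = g)
  (hsurj : ∀ q, Function.Surjective (hG.carrierMap q))

/-- Cycles of `S.toComplex` are determined by their image under `iCycles`; Mathlib's concrete
`cyclesMk` of a cocycle is `cycleOf`. [folklore] -/
theorem cyclesMk_eq_cycleOf (S : Subcomplex R L₁ M₁) (q : ℕ) (z : S.cocycles q)
    (hz : (S.toComplex.d q (q + 1)) (⟨z, ((S.mem_cocycles_iff q _).1 z.2).1⟩ : S.carrier q) = 0) :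
    S.toComplex.cyclesMk (⟨z, ((S.mem_cocycles_iff q _).1 z.2).1⟩ : S.carrier q) (q + 1)
        (CochainComplex.next ℕ q) hz = S.cycleOf q z := by
  apply S.iCycles_injective q
  rw [iCycles_cycleOf]
  exact S.toComplex.i_cyclesMk _ (q + 1) (CochainComplex.next ℕ q) hz

include hinj in
/-- If `F x₁ = d x₂` then `x₁` is a cocycle (`F` injective, `F d = d F`, `d d = 0`). [folklore] -/
theorem mem_cocycles_of_map_eq_dRes (q : ℕ) (x₂ : S₂.carrier q) (x₁ : S₁.carrier (q + 1))
    (hx₁ : F (q + 1) x₁ = S₂.dRes q x₂) : (x₁ : Cochain R L₁ M₁ (q + 1)) ∈ S₁.cocycles (q + 1) := by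
  refine (S₁.mem_cocycles_iff (q + 1) _).2 ⟨x₁.2, ?_⟩
  have hx : hF.carrierMap (q + 1) x₁ = S₂.dRes q x₂ := Subtype.ext hx₁
  have h : hF.carrierMap (q + 2) (S₁.dRes (q + 1) x₁) = 0 := by
    rw [← hF.dRes_carrierMap, hx]
    exact S₂.dRes_dRes q x₂
  have h0 : S₁.dRes (q + 1) x₁ = 0 := hinj (q + 2) (by rw [h, map_zero])
  exact congrArg Subtype.val h0

include hGF hinj hex hsurj in
/-- **The formula for `δ`**: if `z₃` is a cocycle of `S₃`, `x₂ ∈ S₂` lifts it and `x₁ ∈ S₁`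
satisfies `F x₁ = d x₂`, then `δ [z₃] = [x₁]`. [cite: ChevalleyEilenberg1948, §24] -/
theorem delta_toCohomology (q : ℕ) (z₃ : S₃.cocycles q) (x₂ : S₂.carrier q)
    (hx₂ : G q x₂ = (z₃ : Cochain R L₃ M₃ q)) (x₁ : S₁.carrier (q + 1))
    (hx₁ : F (q + 1) x₁ = S₂.dRes q x₂) :
    delta hF hG hGF hinj hex hsurj q (S₃.toCohomology q z₃) =
      S₁.toCohomology (q + 1) ⟨x₁, mem_cocycles_of_map_eq_dRes hF hinj q x₂ x₁ hx₁⟩ := by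
  apply (S₁.cohomologyEquiv (q + 1)).injective
  rw [cohomologyEquiv_delta, cohomologyEquiv_toCohomology, cohomologyEquiv_toCohomology]
  have hz₃ : (S₃.toComplex.d q (q + 1)) (⟨z₃, ((S₃.mem_cocycles_iff q _).1 z₃.2).1⟩ :
      S₃.carrier q) = 0 := S₃.toComplex_d_apply_eq_zero q _ z₃
  have hx₂' : hG.carrierMap q x₂ = (⟨z₃, ((S₃.mem_cocycles_iff q _).1 z₃.2).1⟩ : S₃.carrier q) :=
    Subtype.ext hx₂
  have hx₁' : hF.carrierMap (q + 1) x₁ = (S₂.toComplex.d q (q + 1)) x₂ := by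
    rw [toComplex_d]
    exact Subtype.ext hx₁
  have key := (shortExact hF hG hGF hinj hex hsurj).δ_apply q (q + 1) rfl
    (⟨z₃, ((S₃.mem_cocycles_iff q _).1 z₃.2).1⟩ : S₃.carrier q) hz₃ x₂ hx₂' x₁ hx₁' (q + 2)
    (CochainComplex.next ℕ (q + 1))
  have e₃ : S₃.toComplex.cyclesMk (⟨z₃, ((S₃.mem_cocycles_iff q _).1 z₃.2).1⟩ : S₃.carrier q)
      (q + 1) (CochainComplex.next ℕ q) hz₃ = S₃.cycleOf q z₃ :=
    cyclesMk_eq_cycleOf S₃ q z₃ hz₃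
  have e₁ : S₁.toComplex.cyclesMk x₁ (q + 2) (CochainComplex.next ℕ (q + 1))
      ((shortExact hF hG hGF hinj hex hsurj).d_eq_zero_of_f_eq_d_apply q (q + 1) x₂ x₁ hx₁'
        (q + 2)) =
      S₁.cycleOf (q + 1) ⟨x₁, mem_cocycles_of_map_eq_dRes hF hinj q x₂ x₁ hx₁⟩ := by
    apply S₁.iCycles_injective (q + 1)
    rw [iCycles_cycleOf]
    exact (S₁.toComplex.i_cyclesMk x₁ (q + 2) (CochainComplex.next ℕ (q + 1)) _).trans rfl
  rw [← e₃, ← e₁]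
  exact key

include hex hsurj in
/-- **Lifts exist**: every class of `S₃` is `δ`-computable — given a cocycle `z₃` there are
`x₂ ∈ S₂` over it and `x₁ ∈ S₁` with `F x₁ = d x₂`. [folklore] -/
theorem exists_delta_data (q : ℕ) (z₃ : S₃.cocycles q) :
    ∃ (x₂ : S₂.carrier q) (x₁ : S₁.carrier (q + 1)),
      G q x₂ = (z₃ : Cochain R L₃ M₃ q) ∧ F (q + 1) x₁ = S₂.dRes q x₂ := by
  obtain ⟨x₂, hx₂⟩ := hsurj q ⟨z₃, ((S₃.mem_cocycles_iff q _).1 z₃.2).1⟩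
  have hx₂' : G q x₂ = (z₃ : Cochain R L₃ M₃ q) := congrArg Subtype.val hx₂
  have hd : G (q + 1) (S₂.dRes q x₂) = 0 := by
    have h := congrArg Subtype.val (hG.dRes_carrierMap q x₂)
    simp only [IsCochainMapTo.coe_carrierMap] at h
    rw [← h, hx₂]
    exact ((S₃.mem_cocycles_iff q _).1 z₃.2).2
  obtain ⟨x₁, hx₁⟩ := hex (q + 1) _ hd
  exact ⟨x₂, x₁, hx₂', hx₁⟩

section Smul

variable {A : Type*} [CommRing A]
  [Module A M₁] [SMulCommClass R A M₁] [LieSMulComm A L₁ M₁] [S₁.SMulStable A]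
  [Module A M₂] [SMulCommClass R A M₂] [LieSMulComm A L₂ M₂] [S₂.SMulStable A]
  [Module A M₃] [SMulCommClass R A M₃] [LieSMulComm A L₃ M₃] [S₃.SMulStable A]

include hGF hinj hex hsurj in
/-- **`δ` is `A`-linear** for `A`-stable subcomplexes and `A`-linear cochain maps (e.g. the
complex-linear structure on the `(𝔤, K)`-cohomology of complex `(𝔤, K)`-modules). [folklore] -/
theorem delta_smul (hFa : ∀ (q : ℕ) (a : A) (f : Cochain R L₁ M₁ q), F q (a • f) = a • F q f)
    (hGa : ∀ (q : ℕ) (a : A) (g : Cochain R L₂ M₂ q), G q (a • g) = a • G q g) (q : ℕ) (a : A)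
    (x : S₃.Cohomology q) :
    delta hF hG hGF hinj hex hsurj q (a • x) = a • delta hF hG hGF hinj hex hsurj q x := by
  obtain ⟨z₃, rfl⟩ := S₃.toCohomology_surjective q x
  obtain ⟨x₂, x₁, hx₂, hx₁⟩ := exists_delta_data hG hex hsurj q z₃
  have haz : a • (z₃ : Cochain R L₃ M₃ q) ∈ S₃.cocycles q := by
    simpa only [map_smulHom] using (S₃.isCochainMapTo_smul (A := A) a).mapsTo_cocycles q _ z₃.2
  -- the lifts of `a • z₃` are `a • x₂`, `a • x₁`
  let ax₂ : S₂.carrier q := ⟨a • (x₂ : Cochain R L₂ M₂ q), Subcomplex.SMulStable.smul_mem q a _ x₂.2⟩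
  let ax₁ : S₁.carrier (q + 1) :=
    ⟨a • (x₁ : Cochain R L₁ M₁ (q + 1)), Subcomplex.SMulStable.smul_mem (q + 1) a _ x₁.2⟩
  have hax₂ : G q ax₂ = ((⟨a • (z₃ : Cochain R L₃ M₃ q), haz⟩ : S₃.cocycles q) :
      Cochain R L₃ M₃ q) := by
    change G q (a • (x₂ : Cochain R L₂ M₂ q)) = a • (z₃ : Cochain R L₃ M₃ q)
    rw [hGa, hx₂]
  have hax₁ : F (q + 1) ax₁ = S₂.dRes q ax₂ := by
    change F (q + 1) (a • (x₁ : Cochain R L₁ M₁ (q + 1))) = d R L₂ M₂ q (a • (x₂ : Cochain R L₂ M₂ q))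
    rw [hFa, hx₁, d_smul]
    rfl
  rw [← S₃.toCohomology_smul q a z₃ haz, delta_toCohomology hF hG hGF hinj hex hsurj q _ ax₂ hax₂ ax₁ hax₁,
    delta_toCohomology hF hG hGF hinj hex hsurj q z₃ x₂ hx₂ x₁ hx₁,
    ← S₁.toCohomology_smul (q + 1) a _ (mem_cocycles_of_map_eq_dRes hF hinj q ax₂ ax₁ hax₁)]

end Smul

end DeltaFormula

end Literature.Algebra.Lie.ChevalleyEilenberg.Subcomplex
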